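/-
Copyright (c) 2026. All rights reserved.
Released under Apache 2.0 license as described in the file LICENSE.
-/
import Mathlib.RepresentationTheory.Basic
import Mathlib.LinearAlgebra.FiniteDimensional.Basic
import Mathlib.SetTheory.Cardinal.Finite
import HarnessLib

/-!
# Counting equivariant homomorphisms in characteristic prime to the group order

For a finite group `Δ`, a field `k` with `|Δ| ≠ 0` in `k`, and finite-dimensional representations
`W`, `V` of `Δ` over `k`, the space `Hom_Δ(W, V)` of equivariant linear maps is an **exact**
functor of `V` (`k[Δ]` is semisimple: an equivariant map onto a quotient lifts, by a linear section
followed by averaging over `Δ`).  Numerically, for a short exact sequence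
`0 → V₁ → V₂ → V₃ → 0` of representations,

  `|Hom_Δ(W, V₂)| = |Hom_Δ(W, V₁)| · |Hom_Δ(W, V₃)|`  (`natCard_equivariantHom_of_exact`),

which makes `V ↦ log |Hom_Δ(W, V)|` an additive function on finite `k[Δ]`-modules (the
`ψ'`-functions of the proof of Tate's local Euler–Poincaré characteristic formula, Milne, *ADT*
I §2, proof of Thm. 2.8 / Lemma 2.11: "let `ψ'` be the homomorphism `R(G) → ℤ` …"; Serre,
*Cohomologie galoisienne*, II §5.7).  Also Frobenius reciprocity for the permutation module
`Δ → X` (`natCard_equivariantHom_permRep`: `Hom_Δ(W, Map(Δ, X)) ≃ Hom_k(W, X)`) and products.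

## Main definitions and results

* `equivariantHom σ τ` — the `k`-submodule of `W →ₗ[k] V` of `Δ`-equivariant maps.
* `average σ τ f` — `|Δ|⁻¹ ∑_δ τ(δ) ∘ f ∘ σ(δ)⁻¹`; `postcomp_surjective`.
* `natCard_equivariantHom_of_exact`, `natCard_equivariantHom_prod`, `permRep`,
  `natCard_equivariantHom_permRep`.

## References
* J.-P. Serre, *Linear Representations of Finite Groups*, GTM 42 (1977), §1.3 (averaging), §6.1.
  [SerreLinearRepresentations1977]
* J. S. Milne, *Arithmetic Duality Theorems* (2006), I §2, proof of Thm. 2.8. [MilneADT2006]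
-/

noncomputable section

open Function

namespace Literature.RepresentationTheory.FiniteGroups

variable {k : Type*} [Field k] {Δ : Type*} [Group Δ]
variable {W : Type*} [AddCommGroup W] [Module k W]
variable {V : Type*} [AddCommGroup V] [Module k V]
variable {V₁ : Type*} [AddCommGroup V₁] [Module k V₁]
variable {V₂ : Type*} [AddCommGroup V₂] [Module k V₂]
variable {V₃ : Type*} [AddCommGroup V₃] [Module k V₃]

/-- **The `Δ`-equivariant linear maps `W → V`** as a `k`-submodule of `W →ₗ[k] V`.
[cite: SerreLinearRepresentations1977, §1.3] -/
def equivariantHom (σ : Representation k Δ W) (τ : Representation k Δ V) : Submodule k (W →ₗ[k] V) where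
  carrier := {f | ∀ δ : Δ, f ∘ₗ σ δ = τ δ ∘ₗ f}
  zero_mem' := fun δ => by rw [LinearMap.zero_comp, LinearMap.comp_zero]
  add_mem' := fun {f g} hf hg δ => by
    change (f + g) ∘ₗ σ δ = τ δ ∘ₗ (f + g)
    rw [LinearMap.add_comp, LinearMap.comp_add, hf δ, hg δ]
  smul_mem' := fun c f hf δ => by
    change (c • f) ∘ₗ σ δ = τ δ ∘ₗ (c • f)
    rw [LinearMap.smul_comp, LinearMap.comp_smul, hf δ]

/-- Membership in `equivariantHom`, on elements. [folklore] -/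
theorem mem_equivariantHom_iff (σ : Representation k Δ W) (τ : Representation k Δ V) (f : W →ₗ[k] V) :
    f ∈ equivariantHom σ τ ↔ ∀ (δ : Δ) (w : W), f (σ δ w) = τ δ (f w) := by
  constructor
  · intro h δ w
    exact LinearMap.congr_fun (h δ) w
  · intro h δ
    exact LinearMap.ext fun w => h δ w

/-- **Post-composition with an equivariant map** `π : V₂ → V₃`: `Hom_Δ(W, V₂) → Hom_Δ(W, V₃)`.
[folklore] -/
def postcomp (σ : Representation k Δ W) {τ₂ : Representation k Δ V₂} {τ₃ : Representation k Δ V₃}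
    (π : V₂ →ₗ[k] V₃) (hπ : ∀ (δ : Δ) (v : V₂), π (τ₂ δ v) = τ₃ δ (π v)) :
    equivariantHom σ τ₂ →ₗ[k] equivariantHom σ τ₃ where
  toFun f := ⟨π ∘ₗ f.1, (mem_equivariantHom_iff σ τ₃ _).2 fun δ w => by
    rw [LinearMap.comp_apply, (mem_equivariantHom_iff σ τ₂ _).1 f.2 δ w, hπ]
    rfl⟩
  map_add' f g := Subtype.ext (LinearMap.comp_add _ _ _)
  map_smul' c f := Subtype.ext (LinearMap.comp_smul _ _ _)

/-- Unfolding `postcomp`. [folklore] -/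
@[simp] theorem postcomp_apply_coe (σ : Representation k Δ W) {τ₂ : Representation k Δ V₂} {τ₃ : Representation k Δ V₃}
    (π : V₂ →ₗ[k] V₃) (hπ : ∀ (δ : Δ) (v : V₂), π (τ₂ δ v) = τ₃ δ (π v)) (f : equivariantHom σ τ₂) :
    ((postcomp σ π hπ f : equivariantHom σ τ₃) : W →ₗ[k] V₃) = π ∘ₗ (f : W →ₗ[k] V₂) := rfl

/-! ### Averaging over `Δ` -/

section Average

variable [Fintype Δ]

/-- **The averaging operator** `f ↦ |Δ|⁻¹ ∑_δ τ(δ) ∘ f ∘ σ(δ⁻¹)`.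
[cite: SerreLinearRepresentations1977, §1.3] -/
def average (σ : Representation k Δ W) (τ : Representation k Δ V) (f : W →ₗ[k] V) : W →ₗ[k] V :=
  (Fintype.card Δ : k)⁻¹ • ∑ δ : Δ, τ δ ∘ₗ f ∘ₗ σ δ⁻¹

/-- The average of any linear map is equivariant. [cite: SerreLinearRepresentations1977, §1.3] -/
theorem average_mem (σ : Representation k Δ W) (τ : Representation k Δ V) (f : W →ₗ[k] V) :
    average σ τ f ∈ equivariantHom σ τ := by
  rw [mem_equivariantHom_iff]
  intro γ w
  simp only [average, LinearMap.smul_apply, LinearMap.sum_apply, LinearMap.comp_apply, map_smul, map_sum]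
  congr 1
  symm
  refine Fintype.sum_equiv (Equiv.mulLeft γ) _ _ fun δ => ?_
  have hw : σ γ⁻¹ (σ γ w) = w := by
    rw [← Module.End.mul_apply, ← map_mul, inv_mul_cancel, map_one, Module.End.one_apply]
  change τ γ (τ δ (f (σ δ⁻¹ w))) = τ (γ * δ) (f (σ (γ * δ)⁻¹ (σ γ w)))
  rw [mul_inv_rev, map_mul τ, map_mul σ, Module.End.mul_apply, Module.End.mul_apply, hw]

/-- The average of an equivariant map is the map itself (when `|Δ| ≠ 0` in `k`).
[cite: SerreLinearRepresentations1977, §1.3] -/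
theorem average_of_mem (hΔ : (Fintype.card Δ : k) ≠ 0) (σ : Representation k Δ W) (τ : Representation k Δ V)
    {f : W →ₗ[k] V} (hf : f ∈ equivariantHom σ τ) : average σ τ f = f := by
  have hterm : ∀ δ : Δ, τ δ ∘ₗ f ∘ₗ σ δ⁻¹ = f := fun δ => by
    rw [← LinearMap.comp_assoc, ← hf δ, LinearMap.comp_assoc, ← Module.End.mul_eq_comp, ← map_mul, mul_inv_cancel,
      map_one, Module.End.one_eq_id, LinearMap.comp_id]
  simp only [average, hterm, Finset.sum_const, Finset.card_univ]
  rw [← Nat.cast_smul_eq_nsmul k, smul_smul, inv_mul_cancel₀ hΔ, one_smul]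

/-- Averaging commutes with post-composition by an equivariant map. [folklore] -/
theorem postcomp_average (σ : Representation k Δ W) {τ₂ : Representation k Δ V₂} {τ₃ : Representation k Δ V₃}
    (π : V₂ →ₗ[k] V₃) (hπ : ∀ (δ : Δ) (v : V₂), π (τ₂ δ v) = τ₃ δ (π v)) (f : W →ₗ[k] V₂) :
    π ∘ₗ average σ τ₂ f = average σ τ₃ (π ∘ₗ f) := by
  refine LinearMap.ext fun w => ?_
  simp only [average, LinearMap.comp_apply, LinearMap.smul_apply, LinearMap.sum_apply, map_smul, map_sum, hπ]

/-- **`Hom_Δ(W, ·)` is exact**: post-composition with an equivariant surjection is surjective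
(`|Δ| ≠ 0` in `k`; lift by a linear section and average).
[cite: SerreLinearRepresentations1977, §1.3 Thm. 1 (proof)] -/
theorem postcomp_surjective (hΔ : (Fintype.card Δ : k) ≠ 0) (σ : Representation k Δ W)
    {τ₂ : Representation k Δ V₂} {τ₃ : Representation k Δ V₃}
    (π : V₂ →ₗ[k] V₃) (hπ : ∀ (δ : Δ) (v : V₂), π (τ₂ δ v) = τ₃ δ (π v)) (hπs : Surjective π) :
    Surjective (postcomp σ π hπ) := by
  intro g
  obtain ⟨s, hs⟩ := π.exists_rightInverse_of_surjective (LinearMap.range_eq_top.2 hπs)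
  refine ⟨⟨average σ τ₂ (s ∘ₗ g.1), average_mem σ τ₂ _⟩, Subtype.ext ?_⟩
  rw [postcomp_apply_coe, postcomp_average σ π hπ, ← LinearMap.comp_assoc, hs, LinearMap.id_comp,
    average_of_mem hΔ σ τ₃ g.2]

end Average

/-! ### The count along a short exact sequence -/

/-- **`Hom_Δ(W, V₁) ≃ ker(Hom_Δ(W, V₂) → Hom_Δ(W, V₃))`** for `0 → V₁ →ⁱ V₂ →π V₃` exact. [folklore] -/
def equivariantHomKerEquiv (σ : Representation k Δ W) {τ₁ : Representation k Δ V₁} {τ₂ : Representation k Δ V₂}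
    {τ₃ : Representation k Δ V₃} (i : V₁ →ₗ[k] V₂) (hi : ∀ (δ : Δ) (v : V₁), i (τ₁ δ v) = τ₂ δ (i v))
    (π : V₂ →ₗ[k] V₃) (hπ : ∀ (δ : Δ) (v : V₂), π (τ₂ δ v) = τ₃ δ (π v)) (hinj : Injective i)
    (hexact : LinearMap.range i = LinearMap.ker π) :
    equivariantHom σ τ₁ ≃ LinearMap.ker (postcomp σ π hπ) where
  toFun g := ⟨postcomp σ i hi g, by
    rw [LinearMap.mem_ker]
    refine Subtype.ext (LinearMap.ext fun w => ?_)
    change π (i (g.1 w)) = 0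
    exact LinearMap.mem_ker.1 (hexact ▸ LinearMap.mem_range_self i (g.1 w))⟩
  invFun f := ⟨(LinearEquiv.ofInjective i hinj).symm.toLinearMap ∘ₗ
      (f.1.1.codRestrict (LinearMap.range i) fun w => by
        rw [hexact, LinearMap.mem_ker]
        exact LinearMap.congr_fun (congrArg Subtype.val (LinearMap.mem_ker.1 f.2)) w), by
    rw [mem_equivariantHom_iff]
    intro δ w
    apply hinj
    have h1 : ∀ w, i ((LinearEquiv.ofInjective i hinj).symm (f.1.1.codRestrict (LinearMap.range i) (fun w => by
        rw [hexact, LinearMap.mem_ker]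
        exact LinearMap.congr_fun (congrArg Subtype.val (LinearMap.mem_ker.1 f.2)) w) w)) = f.1.1 w := fun w =>
      congrArg Subtype.val ((LinearEquiv.ofInjective i hinj).apply_symm_apply _)
    change i ((LinearEquiv.ofInjective i hinj).symm _) = i (τ₁ δ ((LinearEquiv.ofInjective i hinj).symm _))
    rw [h1, hi, h1]
    exact (mem_equivariantHom_iff σ τ₂ _).1 f.1.2 δ w⟩
  left_inv g := Subtype.ext (LinearMap.ext fun w => hinj (by
    change i ((LinearEquiv.ofInjective i hinj).symm _) = i (g.1 w)
    exact congrArg Subtype.val ((LinearEquiv.ofInjective i hinj).apply_symm_apply _)))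
  right_inv f := Subtype.ext (Subtype.ext (LinearMap.ext fun w => by
    change i ((LinearEquiv.ofInjective i hinj).symm _) = f.1.1 w
    exact congrArg Subtype.val ((LinearEquiv.ofInjective i hinj).apply_symm_apply _)))

/-- **The count `|Hom_Δ(W, V₂)| = |Hom_Δ(W, V₁)| · |Hom_Δ(W, V₃)|`** for a short exact sequence
`0 → V₁ → V₂ → V₃ → 0` of representations of a finite group `Δ` with `|Δ| ≠ 0` in `k`
(everything finite).  This is the additivity of Milne's `ψ'`.
[cite: MilneADT2006, I §2 (proof of Thm. 2.8, Lemma 2.11)] [cite: SerreLinearRepresentations1977, §1.3] -/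
theorem natCard_equivariantHom_of_exact [Fintype Δ] (hΔ : (Fintype.card Δ : k) ≠ 0) (σ : Representation k Δ W)
    {τ₁ : Representation k Δ V₁} {τ₂ : Representation k Δ V₂} {τ₃ : Representation k Δ V₃}
    (i : V₁ →ₗ[k] V₂) (hi : ∀ (δ : Δ) (v : V₁), i (τ₁ δ v) = τ₂ δ (i v))
    (π : V₂ →ₗ[k] V₃) (hπ : ∀ (δ : Δ) (v : V₂), π (τ₂ δ v) = τ₃ δ (π v)) (hinj : Injective i) (hsurj : Surjective π)
    (hexact : LinearMap.range i = LinearMap.ker π) :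
    Nat.card (equivariantHom σ τ₂) = Nat.card (equivariantHom σ τ₁) * Nat.card (equivariantHom σ τ₃) := by
  let Φ : equivariantHom σ τ₂ →ₗ[k] equivariantHom σ τ₃ := postcomp σ π hπ
  have h1 : Nat.card (equivariantHom σ τ₂) = Nat.card (LinearMap.ker Φ) * Nat.card (equivariantHom σ τ₂ ⧸ LinearMap.ker Φ) :=
    Submodule.card_eq_card_quotient_mul_card (LinearMap.ker Φ)
  have h2 : Nat.card (equivariantHom σ τ₂ ⧸ LinearMap.ker Φ) = Nat.card (LinearMap.range Φ) :=
    Nat.card_congr (Φ.quotKerEquivRange).toEquiv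
  have h3 : Nat.card (LinearMap.range Φ) = Nat.card (equivariantHom σ τ₃) := by
    rw [LinearMap.range_eq_top.2 (postcomp_surjective hΔ σ π hπ hsurj)]
    exact Nat.card_congr (LinearEquiv.ofTop (⊤ : Submodule k (equivariantHom σ τ₃)) rfl).toEquiv
  rw [h1, h2, h3, Nat.card_congr (equivariantHomKerEquiv σ i hi π hπ hinj hexact).symm]

/-- **Products**: `Hom_Δ(W, V × V') ≃ Hom_Δ(W, V) × Hom_Δ(W, V')`. [folklore] -/
def equivariantHomProdEquiv (σ : Representation k Δ W) (τ : Representation k Δ V) (τ' : Representation k Δ V₁) :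
    equivariantHom σ (τ.prod τ') ≃ equivariantHom σ τ × equivariantHom σ τ' where
  toFun f := (⟨LinearMap.fst k V V₁ ∘ₗ f.1, (mem_equivariantHom_iff _ _ _).2 fun δ w => by
      have := (mem_equivariantHom_iff _ _ _).1 f.2 δ w
      exact congrArg Prod.fst this⟩,
    ⟨LinearMap.snd k V V₁ ∘ₗ f.1, (mem_equivariantHom_iff _ _ _).2 fun δ w => by
      have := (mem_equivariantHom_iff _ _ _).1 f.2 δ w
      exact congrArg Prod.snd this⟩)
  invFun g := ⟨g.1.1.prod g.2.1, (mem_equivariantHom_iff _ _ _).2 fun δ w =>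
    Prod.ext ((mem_equivariantHom_iff _ _ _).1 g.1.2 δ w) ((mem_equivariantHom_iff _ _ _).1 g.2.2 δ w)⟩
  left_inv f := Subtype.ext (LinearMap.ext fun _ => rfl)
  right_inv g := Prod.ext (Subtype.ext (LinearMap.ext fun _ => rfl)) (Subtype.ext (LinearMap.ext fun _ => rfl))

/-- `|Hom_Δ(W, V × V')| = |Hom_Δ(W, V)| · |Hom_Δ(W, V')|`. [folklore] -/
theorem natCard_equivariantHom_prod (σ : Representation k Δ W) (τ : Representation k Δ V) (τ' : Representation k Δ V₁) :
    Nat.card (equivariantHom σ (τ.prod τ')) = Nat.card (equivariantHom σ τ) * Nat.card (equivariantHom σ τ') := by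
  rw [Nat.card_congr (equivariantHomProdEquiv σ τ τ'), Nat.card_prod]

/-! ### The permutation module `Map(Δ, X)` and Frobenius reciprocity -/

/-- **The permutation (co-induced from the trivial subgroup) module `Map(Δ, X)`**:
`(δ' · x)(δ) = x(δ δ')`. [cite: SerreLinearRepresentations1977, §3.3] -/
def permRep (Δ : Type*) [Group Δ] (X : Type*) [AddCommGroup X] [Module k X] : Representation k Δ (Δ → X) where
  toFun δ' := LinearMap.funLeft k X (· * δ')
  map_one' := by
    refine LinearMap.ext fun x => funext fun δ => ?_
    simp
  map_mul' a b := by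
    refine LinearMap.ext fun x => funext fun δ => ?_
    simp [mul_assoc]

/-- Unfolding `permRep`. [folklore] -/
@[simp] theorem permRep_apply_apply (X : Type*) [AddCommGroup X] [Module k X] (δ' : Δ) (x : Δ → X) (δ : Δ) :
    permRep (k := k) Δ X δ' x δ = x (δ * δ') := rfl

/-- **Frobenius reciprocity `Hom_Δ(W, Map(Δ, X)) ≃ Hom_k(W, X)`**, `f ↦ (w ↦ f(w)(1))`, inverse
`h ↦ (w ↦ (δ ↦ h(δ w)))`. [cite: SerreLinearRepresentations1977, §7.2] -/
def equivariantHomPermRepEquiv (σ : Representation k Δ W) (X : Type*) [AddCommGroup X] [Module k X] :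
    equivariantHom σ (permRep (k := k) Δ X) ≃ (W →ₗ[k] X) where
  toFun f := (LinearMap.proj 1) ∘ₗ f.1
  invFun h := ⟨LinearMap.pi fun δ => h ∘ₗ σ δ, (mem_equivariantHom_iff _ _ _).2 fun δ' w => funext fun δ => by
    simp only [LinearMap.pi_apply, LinearMap.comp_apply, permRep_apply_apply, map_mul, Module.End.mul_apply]⟩
  left_inv f := Subtype.ext (LinearMap.ext fun w => funext fun δ => by
    have h := (mem_equivariantHom_iff _ _ _).1 f.2 δ w
    have h' := congrFun h 1
    simp only [permRep_apply_apply, one_mul] at h'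
    simpa using h')
  right_inv h := LinearMap.ext fun w => by simp

/-- `|Hom_Δ(W, Map(Δ, X))| = |Hom_k(W, X)|`. [cite: SerreLinearRepresentations1977, §7.2] -/
theorem natCard_equivariantHom_permRep (σ : Representation k Δ W) (X : Type*) [AddCommGroup X] [Module k X] :
    Nat.card (equivariantHom σ (permRep (k := k) Δ X)) = Nat.card (W →ₗ[k] X) :=
  Nat.card_congr (equivariantHomPermRepEquiv σ X)

end Literature.RepresentationTheory.FiniteGroups

end
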